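import Summits.BirchSwinnertonDyer.BirchSwinnertonDyer.Theses.TameQuarticManinParity
import Literature.NumberTheory.EllipticCurves.ModularJacobianNeronDifferentialsTameProofs
import HarnessLib

/-!
# Route `TameQuarticManinParity`, LINE 38/41 (bsd-idea-3 g11), support N38c `ManinUnitIffTameColengthBound`
# (stmt-BirchSwinnertonDyer-24043) — PROVED BY NAME over the landed carrier `TameNeronFormsAt` (p692978)

Cell `pub/bsd-wall`, D-0145 line `route-BirchSwinnertonDyer-TeichmullerTwistDescent`, seat `bsd-line-ttd-p1` g15,
working the planner-of-record's TQMP LINE 38/41. BSD is NOT proved by this; Manin's conjecture is not proved by this;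
the crux COL(III) (`TprimeIIIColengthBound`, stmt-24044) stays OPEN. This file closes ONLY the typed corollary (C1).

## Statement (verbatim the route decl)

For `Λ : TameNeronFormsAt N 3 8`, a globally minimal `W`, a lattice-optimal datum `D` of `W` at level `N` and
an exponent `a` with `HasTameGoodModel 3 8 W a`: `¬ 3 ∣ D.maninConstant ↔ Λ.tameColength D a ≤ a`.

## Proof

Literally the typer's theorem `TameNeronFormsAt.not_dvd_maninConstant_iff_tameColength_le_of_hasTameGoodModel`
(`ModularJacobianNeronDifferentialsTameProofs`) at `(p, e) = (3, 8)`. Design: theorems only; no definition, no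
named fact, no `sorry`; axioms `propext`, `Classical.choice`, `Quot.sound`.
-/

set_option autoImplicit false
-- D-0017: single-problem summit, so `Summit.BirchSwinnertonDyer.BirchSwinnertonDyer.…` repeats a namespace BY DESIGN.
set_option linter.dupNamespace false

namespace Summit.BirchSwinnertonDyer.BirchSwinnertonDyer.Theorems.TameQuarticManinParity

open Summit.BirchSwinnertonDyer.BirchSwinnertonDyer.Theses.TameQuarticManinParity
open Literature.NumberTheory.EllipticCurves.ModularForms

/-- **N38c, «Manin 3-unit ⟺ tame colength bound»** (stmt-BirchSwinnertonDyer-24043), by name: for a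
lattice-optimal datum of a globally minimal curve with `HasTameGoodModel 3 8 W a`, `3 ∤ c ⟺ col_K ≤ a` — the typer's
`not_dvd_maninConstant_iff_tameColength_le_of_hasTameGoodModel` at `(p, e) = (3, 8)`.
[cite: EdixhovenManin1991, §4 Prop. 8] -/
theorem maninUnitIffTameColengthBound_proof : ManinUnitIffTameColengthBound := by
  unfold ManinUnitIffTameColengthBound
  intro N _ Λ W _ _ D hL a ha
  exact Λ.not_dvd_maninConstant_iff_tameColength_le_of_hasTameGoodModel Nat.prime_three (by norm_num) D hL ha

end Summit.BirchSwinnertonDyer.BirchSwinnertonDyer.Theorems.TameQuarticManinParity
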